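import Literature.NumberTheory.Sieve.MoebiusWalshCircuitsProofs
import Literature.NumberTheory.LFunctions.MoebiusWalshUniformHolds
import HarnessLib

/-!
# Bourgain 2013, Theorem 1 for `μ` — discharge of `bourgain_moebius_walsh`

Topic `Literature/NumberTheory/Sieve`, a proofs companion of `MoebiusWalshCircuits.lean` (named fact
`bourgain_moebius_walsh`: J. Bourgain, *Möbius–Walsh correlation bounds and an estimate of Mauduit
and Rivat*, J. Anal. Math. **119** (2013) 147–163 = arXiv:1109.2784 [Bourgain2013MoebiusWalsh],
Theorem 1, (0.3)). Everything here is PROVED (one theorem; no definition, no named fact).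

`Literature.NumberTheory.Sieve.bourgain_moebius_walsh` ("for `λ` large enough,
`max_{A ⊆ {0,…,λ-1}} |∑_{n<2^λ} μ(n) w_A(n)| < 2^{λ-λ^{1/10}}`", in the `range (2^n)`/`testBit`
vocabulary, `∀ᶠ n`) is equivalent to the `LFunctions` vendoring
`Literature.NumberTheory.LFunctions.bourgain_moebius_walsh_uniform` (cube sum `walshSum`, `∃ n₀`)
by the proved bridge `Literature.NumberTheory.Sieve.bourgain_moebius_walsh_iff_uniform`
(`MoebiusWalshCircuitsProofs.lean`: binary expansion is a bijection `{0,1}ⁿ ≃ [0, 2ⁿ)`, `μ(0) = 0`).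
The latter is PROVED in the tree
(`Literature.NumberTheory.LFunctions.bourgain_moebius_walsh_uniform_holds`,
`LFunctions/MoebiusWalshUniformHolds.lean`: Green's Proposition 1 for the small weights, the
Vaughan-type reduction, Bourgain's type-I (§3) and type-II (§2) box estimates, the numerics of
(3.10)); this file transports that discharge.

## References

* J. Bourgain, J. Anal. Math. 119 (2013) 147–163; arXiv:1109.2784, Theorem 1, (0.3).
  [Bourgain2013MoebiusWalsh]
-/

namespace Literature.NumberTheory.Sieve

/-- **Bourgain 2013, Theorem 1 (Möbius–Walsh) — PROVED** (discharge of the named fact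
`bourgain_moebius_walsh`): for all sufficiently large `n` and every `A ⊆ {0,…,n-1}`,
`|∑_{x<2ⁿ} μ(x) w_A(x)| < 2^{n - n^{1/10}}`, `w_A(x) = ∏_{j ∈ A} (1 - 2x_j)`. Transported from the
`LFunctions` form `Literature.NumberTheory.LFunctions.bourgain_moebius_walsh_uniform_holds` through
the proved equivalence `bourgain_moebius_walsh_iff_uniform`.
[cite: Bourgain2013MoebiusWalsh, Theorem 1, (0.3)] -/
theorem bourgain_moebius_walsh_holds : bourgain_moebius_walsh :=
  bourgain_moebius_walsh_iff_uniform.mpr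
    Literature.NumberTheory.LFunctions.bourgain_moebius_walsh_uniform_holds

end Literature.NumberTheory.Sieve
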